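import Summits.ABC.IUTFork.Joshi.LogVolumesHullsScaling

/-!
# (9.9.4) is RIGID against label-independent absolute values: a located arithmetic line for E-LOCATION §L2
# (block E of the abc-iut cell, rung LADDER-ABC:A2.E; seat abc-iut-E-t56 — typer-side second reader of lane B, rider
# offered on STATUS 2026-08-26T08:42Z / 08:46Z after the reads of p432005 / p432258 / p432636)

K. Joshi, *Construction of Arithmetic Teichmüller Spaces III* (arXiv:2401.13508 **v4**, unrefereed; bib `Joshi2024ATS3`;
render `HOME/lit/renders/Joshi-arxiv-2401.13508/pNNNN.txt`, «p.N l.M»). PROOF-ONLY rider over two landed carriers BY NAME: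
abc-iut-E-t4's `ATS3.LocusDatum ℓ*` (p428048; `ValuationScaling` = (9.9.4) «|log_BK(ξ_{w,j})|_{L′_{w,j}} = |q^{1/2ℓ}_{w;1}|^{j²/ℓ*²}»,
p.121 l.39–66, with the base read at the standard component, exponent `scalingExponent ℓ* i = ((i+1)/ℓ*)²`) and abc-iut-E-t23's
`LogVol.ScalingDatum` (p429684; `RootScaling e` = (9.9.4) with the exponent law as a parameter, over per-label §9.10.2
volume data `D i : VolumeDatum (E i)` whose absolute value `(D i).abs` is the one Lemma 9.10.2.2 (2) «Vol_E(α + λ𝒪_E) = |λ|_E»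
(p.123 l.24–38) ties to the Haar volume — at a genuine local field the MODULE, abc-iut-E-t23 p432005 `localFieldVolumeDatum`).

WHAT IS PROVED (real arithmetic only; numbers, NO verdict on print). If the norms that (9.9.4) constrains do NOT depend on the
label — as happens whenever every label `j` is given the SAME field `L′_w` with the SAME Vol-compatible absolute value and the
SAME element (the Tate-parameter root `q_w^{1/2ℓ}` of the fixed curve `C/L′_w`) — then (9.9.4) forces `ℓ* ≤ 1`:
`qroot^{(1/ℓ*)²} = qroot^{1}` with `0 < qroot < 1` gives `(1/ℓ*)² = 1`. Equivalently, for `ℓ* ≥ 2` (print: `ℓ ≥ 5`, so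
`ℓ* ≥ 2`) the label-dependence of `|−|_{L′_{w,j}}` (Joshi's reading through the perfectoid residue fields `K_{y_j}`, Thm.
4.2.2.1 (4) p.33 l.3–12) must ALSO be carried by the volume side of §9.10 — which Lemma 9.10.2.2's single normalised Haar
measure on the fixed `p`-adic field `L′_w` does not supply; and if it is carried by label-dependent weights/exponents, E-t23's
`LogVol.log_weightedVol_update_sub` (p432636) records that the tuple recipe (9.10.3.1) then assigns different volumes to EQUAL
subsets of the tensor packet. This is the attach point of plan/E/E-LOCATION.md §L2 ((HllVl)/(EssGlIq) ↔ [J-III] §4.5, (9.9.4))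
in one arithmetic line; it locates, it adjudicates nothing. The ℓ* = 1 inhabitants of E-t23 (p430954 `padicExhibitedDatum`,
p432258 `padicScalingDatum`) are consistent with it and, by it, cannot be upgraded to ℓ* ≥ 2 over one local field with one
absolute value. NUANCE (abc-iut-E-t23, STATUS 08:54:01Z): in print the exhibited classes `τ_j = log_BK(Ξ_{0,z_j,w})` (p.127 l.53)
and the roots `q^{1/2ℓ}_{w;j}` (p.120 l.120) are a priori DIFFERENT elements (classes at the different arithmeticoids `y_j` of the
standard point), so the label-dependence that (9.9.4) demands may live in the ELEMENTS rather than in the absolute value; the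
hypothesis of the lemmas below is only «the NORMS are label-independent», and the located reading is: if moreover the `q^{1/2ℓ}_{w;j}`
are one element of one valued field (print's «writing q_w in place of q_{w;1}», p.121 l.67) then (9.9.4) is impossible for `ℓ* ≥ 2`
— the j-dependence must come from the untilt-dependent norms of Thm. 4.2.2.1 (4) (slot T-07), consistent with L2/L6. FRAMING: the cell locates / conditionally verifies; NO abc claim; no side taken on [IUTchIII] Cor. 3.12 or on any
author (Mochizuki / Scholze–Stix / Joshi / Dupuy–Hilado); typed ≠ proved; nothing of Joshi's is asserted here.
-/

noncomputable section

namespace Summit.ABC.IUTFork.Joshi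

namespace ATS3.LocusDatum

variable {lstar : ℕ} (d : ATS3.LocusDatum lstar)

/-- The (9.9.4) exponent at the LAST label `j = ℓ*` is `1` (the standard component `y_{ℓ*} = y′_0`, [J-III] §4.5 p.36
l.11–17). [folklore] -/
theorem scalingExponent_last (h : 1 ≤ lstar) :
    scalingExponent lstar ⟨lstar - 1, Nat.sub_lt h Nat.one_pos⟩ = 1 := by
  unfold scalingExponent
  have hl : (lstar : ℝ) ≠ 0 := by exact_mod_cast (show lstar ≠ 0 by omega)
  have hc : (((lstar - 1 : ℕ) : ℝ) + 1) = (lstar : ℝ) := by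
    rw [Nat.cast_sub h]; push_cast; ring
  rw [show ((((⟨lstar - 1, Nat.sub_lt h Nat.one_pos⟩ : Fin lstar) : ℕ) : ℝ) + 1) = (lstar : ℝ) from hc,
    div_self hl, one_pow]

/-- The (9.9.4) exponent at the FIRST label `j = 1` is `(1/ℓ*)²`. [folklore] -/
theorem scalingExponent_first (h : 1 ≤ lstar) : scalingExponent lstar ⟨0, h⟩ = (1 / (lstar : ℝ)) ^ 2 := by
  unfold scalingExponent
  simp

/-- For `ℓ* ≥ 2` the first exponent is STRICTLY below the last one: `(1/ℓ*)² < 1`. [folklore] -/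
theorem scalingExponent_first_lt_one (h : 2 ≤ lstar) : scalingExponent lstar ⟨0, by omega⟩ < 1 := by
  rw [scalingExponent_first (by omega)]
  have hl : (1 : ℝ) < (lstar : ℝ) := by exact_mod_cast (show 1 < lstar by omega)
  have h0 : (0 : ℝ) ≤ 1 / (lstar : ℝ) := by positivity
  have h1 : 1 / (lstar : ℝ) < 1 := by
    rw [div_lt_one (by linarith)]; exact hl
  calc (1 / (lstar : ℝ)) ^ 2 < (1 : ℝ) ^ 2 := pow_lt_pow_left₀ h1 h0 (by norm_num)
    _ = 1 := one_pow 2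

/-- Under (9.9.4) the exhibited norms are STRICTLY decreasing from the last label to the first when `ℓ* ≥ 2`:
`|log_BK(ξ_{w,1})| > |log_BK(ξ_{w,ℓ*})|` (base `qroot ∈ (0,1)`, exponents `(1/ℓ*)² < 1`). [folklore] -/
theorem theta_last_lt_theta_first_of_valuationScaling (h : 2 ≤ lstar) (hV : d.ValuationScaling) :
    d.theta ⟨lstar - 1, by omega⟩ < d.theta ⟨0, by omega⟩ := by
  rw [hV, hV, scalingExponent_last (by omega)]
  have hlt := scalingExponent_first_lt_one h
  calc d.qroot ^ (1 : ℝ) < d.qroot ^ scalingExponent lstar ⟨0, by omega⟩ :=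
        Real.rpow_lt_rpow_of_exponent_gt d.qroot_pos d.qroot_lt_one hlt
    _ = d.qroot ^ scalingExponent lstar ⟨0, by omega⟩ := rfl

/-- **RIGIDITY of (9.9.4), E-t4's carrier** (numbers, no verdict): if the exhibited norms `theta i = |log_BK(ξ_{w,j})|` do
not depend on the label, then `ValuationScaling` forces `ℓ* ≤ 1`. Contrapositive reading for `ℓ* ≥ 2` (print: `ℓ ≥ 5`): the
absolute values `|−|_{L′_{w,j}}` of (9.9.4) MUST depend on `j` — they cannot all be one Vol-compatible absolute value of the one
`p`-adic field `L′_w` evaluated at one element. [folklore] -/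
theorem lstar_le_one_of_valuationScaling_of_theta_const (hV : d.ValuationScaling)
    (hc : ∀ i j : Fin lstar, d.theta i = d.theta j) : lstar ≤ 1 := by
  by_contra hlt
  have h2 : 2 ≤ lstar := by omega
  exact absurd (hc ⟨lstar - 1, by omega⟩ ⟨0, by omega⟩)
    (d.theta_last_lt_theta_first_of_valuationScaling h2 hV).ne

/-- The same, packaged as an incompatibility at `ℓ* ≥ 2`. [folklore] -/
theorem not_valuationScaling_of_theta_const (h : 2 ≤ lstar) (hc : ∀ i j : Fin lstar, d.theta i = d.theta j) :
    ¬ d.ValuationScaling := fun hV =>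
  absurd (d.lstar_le_one_of_valuationScaling_of_theta_const hV hc) (by omega)

end ATS3.LocusDatum

namespace LogVol.ScalingDatum

open MeasureTheory

variable {lstar : ℕ} {E : Fin lstar → Type*} [∀ i, Field (E i)] [∀ i, MeasurableSpace (E i)] {X : Type*}
  [MeasurableSpace X] (Dw : LogVol.ScalingDatum lstar E X)

/-- **RIGIDITY of (9.9.4), E-t23's carrier** (numbers, no verdict): if the §9.10.2 absolute values of the Tate-parameter
roots `|q^{1/2ℓ}_{w;j}|` do not depend on the label `j` — e.g. every label carries the same local field `L′_w` with its
Vol-compatible module (p432005 `localFieldVolumeDatum`) and `q^{1/2ℓ}_{w;j}` is the one root of the Tate parameter of the fixed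
curve `C/L′_w` — then `RootScaling scalingExponent` ((9.9.4) with print's exponent law) forces `ℓ* ≤ 1`. [folklore] -/
theorem lstar_le_one_of_rootScaling_of_abs_const
    (h : Dw.RootScaling (ATS3.LocusDatum.scalingExponent lstar))
    (hc : ∀ i j : Fin lstar, (Dw.D i).abs (Dw.qrt i) = (Dw.D j).abs (Dw.qrt j)) : lstar ≤ 1 := by
  by_contra hlt
  have h2 : 2 ≤ lstar := by omega
  have hq0 := Dw.qroot_pos
  have hq1 := Dw.qroot_lt_one
  have hlast : (Dw.D ⟨lstar - 1, by omega⟩).abs (Dw.qrt ⟨lstar - 1, by omega⟩) = Dw.qroot ^ (1 : ℝ) := by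
    rw [h, ATS3.LocusDatum.scalingExponent_last (by omega)]
  have hfirst : (Dw.D ⟨0, by omega⟩).abs (Dw.qrt ⟨0, by omega⟩) =
      Dw.qroot ^ ATS3.LocusDatum.scalingExponent lstar ⟨0, by omega⟩ := h _
  have hlt' : Dw.qroot ^ (1 : ℝ) < Dw.qroot ^ ATS3.LocusDatum.scalingExponent lstar ⟨0, by omega⟩ :=
    Real.rpow_lt_rpow_of_exponent_gt hq0 hq1 (ATS3.LocusDatum.scalingExponent_first_lt_one h2)
  have := hc ⟨lstar - 1, by omega⟩ ⟨0, by omega⟩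
  rw [hlast, hfirst] at this
  exact absurd this hlt'.ne

/-- With (9.9.2)–(9.9.3) (`NormLogBK`) the same rigidity reads on the exhibited classes: label-independent
`|log_BK(ξ_{w,j})|` ∧ (9.9.4) ⇒ `ℓ* ≤ 1` — E-t4's form through the projection `toLocusDatum`. [folklore] -/
theorem lstar_le_one_of_inputs_of_norm_const (h1 : Dw.NormLogBK)
    (h2 : Dw.RootScaling (ATS3.LocusDatum.scalingExponent lstar))
    (hc : ∀ i j : Fin lstar, (Dw.D i).abs (Dw.τ i) = (Dw.D j).abs (Dw.τ j)) : lstar ≤ 1 :=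
  Dw.toLocusDatum.lstar_le_one_of_valuationScaling_of_theta_const (Dw.valuationScaling_of h1 h2)
    fun i j => by rw [LogVol.ExhibitedDatum.toLocusDatum_theta, LogVol.ExhibitedDatum.toLocusDatum_theta]; exact hc i j

end LogVol.ScalingDatum

end Summit.ABC.IUTFork.Joshi

end
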